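import Mathlib.MeasureTheory.Measure.Lebesgue.Basic
import Summits.QuantumFields.BalabanUV.T4Continuum.Support.ShellMeasureRootComposition

/-!
# `T4Continuum.ShellMeasureRootCompositionToy` — NON-VACUITY OF END-I: the binder list of
# `ShellMeasureRootComposition.shellWeightBound_of_slotAC` INHABITED on the one-slot toy of `T4ShellMeasureLevels.Toy`
# with a UNIFORM tested variable, and the END FIRING with a strictly positive shell part
(cell `pub-balaban`, sub-cell `t4`, spine estimate NE7c (node U5b); ROUND-2 crew `t4-ne7c-formalise-*` under
`t4/T4-NE7c-TRIGGER.json`, row S10 of the claim table `t4/b2b-balaban-t4-ne7c-p1/LEAVES-NE7c-P1.md`, seat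
`b2b-balaban-t4-ne7c-formalise-leaf-01`; ADDITIVE — imports the row owner's `ShellMeasureRootComposition` (row S7a,
p207618) and Mathlib's Lebesgue measure only; 0 `def`, 0 sorry; the toy data are literal terms.)

HONEST FRAMING.  Finite four-torus programme, rung (B)+1 only — NOT infinite volume, NOT a mass gap, NOT the Clay
problem, NOT summit progress.  NE7c = `T4IndicatorShell.ShellWeightBound` is NOT PRINTED in [Balaban 1983–89] and NOT
PROVED; END-I is the composition «NE7c ⇐ the named binders» (trigger c3).  THIS FILE IS A TOY: it shows that END-I's
binder list — per run the expansion reading (R), the [dict] push `piece_le`/`total_ge`, THE WALL (M1)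
`T4ShellMeasure.SlotAntiConcentration` per slot by level, the live window (W1) with slot count, `D_j ≤ D̄`, and the
width rate `ρ_j ≤ c₁ϑ^j` (or, for the band twin, `Summable ρ` + age counts) — is JOINTLY SATISFIABLE by NON-DEGENERATE
data and that the END then FIRES with a strictly positive shell part.  Nothing of Bałaban's is instantiated, no estimate
of the cell is touched, no binder of the real problem is discharged: (M1) for Bałaban's inductive measures stays THE
wall (GAPS G-ne7cp1-1), located, NOT PRINTED; 0/9 spine.  HONEST DEPENDENCY (cell): continuum YM on T⁴ ⇐ BetaPertH ∧
nine spine estimates (0/9 proved); BetaPertH ⇐ (D1) ∧ (D4) ∧ CAP+tail; G-an2-4 gates asym, D1 and NE2/3/4.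

## The toy (literal data; no definition introduced)

Term level = `T4ShellMeasureLevels.Toy` (p190827): one term `()` per step `K` of weight `A ≡ 1`, shell part
`sh x K t τ = x^K`, one slot `()` per step sitting at the TOP level `lvl K s = K`, its piece the whole shell part
`piece x K t s τ = x^K`, constant `D ≡ 1`, width `ρ x j = x^j` — for a run parameter `x`.  Measure level (this file):
the slot's realized configuration space is `ℝ`, its realized measure the UNIFORM LAW `volume.restrict (Icc 0 1)` (total
mass `1`), its tested variable the identity, threshold `θ ≡ 1`, [dict] constant `M ≡ 1`.  Then the level-`K` threshold
shell `{1·(1 − x^K) ≤ u < 1} = [1 − x^K, 1)` has mass EXACTLY `x^K = ρ_K` (§1): (M1) holds with `D = 1` and EQUALITY,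
and `D = 1` is SHARP (`slotAC_unif_iff`); the pushes `piece_le`/`total_ge` hold with EQUALITY (§2).

## What is proved (all [folklore])

* §1 the uniform slot measure: `unif_shell` (shell mass `= ofReal ρ`), `unif_univ`, `slotAC_unif` ((M1), `D = 1`),
  `slotAC_unif_iff` (`D = 1` sharp).
* §2 END-I's binders on one toy run with parameter `0 ≤ x ≤ 1` ((R) from `Toy.levelLedger`; `toy_M_nonneg`,
  `toy_piece_le`, `toy_total_ge`, `toy_slotAC`, `toy_D_le`, `toy_rate` (`x ≤ ϑ`), and for the band twin `toy_ageCount`,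
  `toy_summable_ρ`).
* §3 END-I FIRES (`toy_shellWeightBound` = `shellWeightBound_of_slotAC` on two toy runs with parameters `a, b ∈ (0, ϑ]`,
  `ϑ < 1`, common rate base `ϑ`; weight `K ↦ a^K + b^K`, `toy_weight_eq`, `toy_shellWeightBound'`); the BAND TWIN FIRES
  (`toy_shellWeightBound_band` = `shellWeightBound_of_slotAC_band`, `a, b ∈ (0, 1)` independent, age count `m ≡ 1`);
  END-I THROUGH THE SEAM (ζ′) FIRES on the diagonal `a = b` (`toy_hybridNE7_tail` = `hybridNE7_tail_of_slotAC` with the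
  slot-free NE7b half and the zero budget on the hybrid cores `1 − a^K` — `toy_relWeightBound`, `toy_reindexedBudget`).
* §4 NON-DEGENERACY: the shell part is strictly positive (`toy_sh_pos`), the slot is LIVE at every step (its threshold
  shell has positive mass, `toy_shellMass_pos`), run A's own relative shell weight is exactly `a^K` (`toy_relShell_eq`),
  and the per-slot constant cannot be lowered (`toy_slotAC_iff`).
* §5 (v1.1) the piece is an honest integral (`toy_piece_integrable`, `toy_piece_eq_integral`).
* §6 (v1.2) the typer's acceptance shape as ONE closed theorem: `toy_END_I` (END-I applied ∧ `0 < Wsh K` for all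
  `K`), `toy_END_I_half` (parameter-free `∃ Wsh, ShellWeightBound … Wsh ∧ 0 < Wsh K₀`), `toy_weight_pos`.

WHAT THIS DOES NOT DO.  It is not evidence for (M1) on Bałaban's measures; it changes nothing in the countdown.

v1.1 (append-only; crew referee DV-4, `t4/formal/NE7c/REFEREE.md`: «keep `piece` an HONEST integral»).  §5: the toy's
piece `x^K` IS the Bochner integral, against the slot's realized (uniform) measure, of the indicator of the slot's
threshold shell — an integrable integrand on a finite measure, no junk value (`toy_piece_integrable`,
`toy_piece_eq_integral`); so §2's push `piece_le` is the honest instance `∫ 1_shell dμ ≤ 1·μ(shell)`.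
-/

open Finset MeasureTheory Set

namespace Summit.QuantumFields.BalabanUV.T4Continuum.ShellMeasureRootCompositionToy

open scoped ENNReal
open Literature.MathematicalPhysics.QuantumFieldTheory.Balaban1983to89
open T4WeightBudget T4IndicatorShell T4MatchingAssembly T4MatchingClosure T4MatchingClosureSocket T4ShellMeasure
open T4ShellMeasureLevels
open ShellMeasureRootComposition

/-! ## §1 The uniform slot measure: (M1) with `D = 1`, attained and sharp -/

section Uniform

variable {ρ : ℝ}

/-- the threshold shell of the identity variable at threshold `1` and width `ρ` is the interval `[1 − ρ, 1)`.
[folklore] -/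
theorem shell_eq_Ico (ρ : ℝ) : {x : ℝ | 1 * (1 - ρ) ≤ x ∧ x < 1} = Ico (1 - ρ) 1 := by
  ext x
  simp

/-- the UNIFORM LAW on `[0, 1]` gives the threshold shell of width `ρ ≤ 1` mass EXACTLY `ofReal ρ` (`= ρ` for
`0 ≤ ρ`; the shell is empty for `ρ ≤ 0`). [folklore] -/
theorem unif_shell (hρ1 : ρ ≤ 1) :
    (volume.restrict (Icc (0 : ℝ) 1)) {x : ℝ | 1 * (1 - ρ) ≤ x ∧ x < 1} = ENNReal.ofReal ρ := by
  have hsub : Ico (1 - ρ) 1 ⊆ Icc (0 : ℝ) 1 :=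
    Ico_subset_Icc_self.trans (Icc_subset_Icc (by linarith) le_rfl)
  rw [shell_eq_Ico, Measure.restrict_apply measurableSet_Ico, inter_eq_left.2 hsub, Real.volume_Ico]
  congr 1
  ring

/-- the uniform law on `[0, 1]` has total mass `1`. [folklore] -/
theorem unif_univ : (volume.restrict (Icc (0 : ℝ) 1)) (univ : Set ℝ) = 1 := by
  rw [Measure.restrict_apply_univ, Real.volume_Icc]
  simp

/-- **(M1) FOR THE UNIFORM LAW WITH CONSTANT `D = 1` — WITH EQUALITY**: the identity variable under the uniform law on
`[0, 1]`, threshold `1`, width `ρ ≤ 1`: `μ{1·(1 − ρ) ≤ u < 1} = ofReal ρ = ofReal (1·ρ)·μ(univ)`. [folklore] -/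
theorem slotAC_unif (hρ1 : ρ ≤ 1) :
    SlotAntiConcentration (volume.restrict (Icc (0 : ℝ) 1)) (fun x => x) 1 ρ 1 := by
  show (volume.restrict (Icc (0 : ℝ) 1)) {x : ℝ | 1 * (1 - ρ) ≤ x ∧ x < 1} ≤
    ENNReal.ofReal (1 * ρ) * (volume.restrict (Icc (0 : ℝ) 1)) (univ : Set ℝ)
  rw [unif_shell hρ1, unif_univ, one_mul, mul_one]

/-- **… AND `D = 1` IS SHARP**: for a width `0 < ρ ≤ 1` the uniform law satisfies (M1) with constant `D` iff `1 ≤ D`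
(END-I's per-slot constant cannot be lowered on the toy). [folklore] -/
theorem slotAC_unif_iff (hρ0 : 0 < ρ) (hρ1 : ρ ≤ 1) {D : ℝ} :
    SlotAntiConcentration (volume.restrict (Icc (0 : ℝ) 1)) (fun x => x) 1 ρ D ↔ 1 ≤ D := by
  show (volume.restrict (Icc (0 : ℝ) 1)) {x : ℝ | 1 * (1 - ρ) ≤ x ∧ x < 1} ≤
      ENNReal.ofReal (D * ρ) * (volume.restrict (Icc (0 : ℝ) 1)) (univ : Set ℝ) ↔ 1 ≤ D
  rw [unif_shell hρ1, unif_univ, mul_one]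
  constructor
  · intro h
    by_contra hD
    have hD' : D < 1 := not_le.1 hD
    have hlt : ENNReal.ofReal (D * ρ) < ENNReal.ofReal ρ := by
      rw [ENNReal.ofReal_lt_ofReal_iff hρ0]
      exact (mul_lt_mul_of_pos_right hD' hρ0).trans_eq (one_mul ρ)
    exact absurd h (not_le.2 hlt)
  · intro hD
    exact ENNReal.ofReal_le_ofReal (le_mul_of_one_le_left hρ0.le hD)

end Uniform

/-! ## §2 END-I's binders on ONE toy run (parameter `x`): every one inhabited, the pushes with equality -/

section OneRun

variable {x : ℝ} (l₀ : ℝ)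

/-- [dict] the proportionality constant `M ≡ 1` is nonnegative (binder `hM`). [folklore] -/
theorem toy_M_nonneg : ∀ K (t : ℝ), |t| ≤ l₀ → ∀ s ∈ Toy.S K, (0 : ℝ) ≤ 1 :=
  fun _ _ _ _ _ => zero_le_one

/-- [dict] PUSH `piece_le` on the toy, WITH EQUALITY: the slot's piece `x^K` weighs exactly `1 ×` the uniform mass
`x^K` of its level-`K` threshold shell `[1 − x^K, 1)` (`0 ≤ x ≤ 1`). [folklore] -/
theorem toy_piece_le (h0 : 0 ≤ x) (h1 : x ≤ 1) :
    ∀ K (t : ℝ), |t| ≤ l₀ → ∀ s ∈ Toy.S K, ∑ τ ∈ Toy.T K, Toy.piece x K t s τ ≤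
      1 * ((volume.restrict (Icc (0 : ℝ) 1))
        {y : ℝ | 1 * (1 - Toy.ρ x (Toy.lvl K s)) ≤ y ∧ y < 1}).toReal := by
  intro K t _ s _
  have hK0 : 0 ≤ x ^ K := pow_nonneg h0 K
  show ∑ τ ∈ Toy.T K, x ^ K ≤
    1 * ((volume.restrict (Icc (0 : ℝ) 1)) {y : ℝ | 1 * (1 - x ^ K) ≤ y ∧ y < 1}).toReal
  rw [unif_shell (pow_le_one₀ h0 h1), ENNReal.toReal_ofReal hK0]
  simp [Toy.T]

/-- [dict] PUSH `total_ge` on the toy, WITH EQUALITY: `1 ×` the total uniform mass `1` is the total term weight `1`.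
[folklore] -/
theorem toy_total_ge : ∀ K (t : ℝ), |t| ≤ l₀ → ∀ s ∈ Toy.S K,
    1 * ((volume.restrict (Icc (0 : ℝ) 1)) (univ : Set ℝ)).toReal ≤ ∑ τ ∈ Toy.T K, Toy.A K t τ := by
  intro K t _ s _
  rw [unif_univ]
  simp [Toy.T, Toy.A]

/-- **THE WALL (M1) ON THE TOY — INHABITED, WITH EQUALITY** (binder `hac`): per slot at its own level `K`, the uniform
law of the tested variable is anti-concentrated at threshold `θ_K = 1`, width `ρ_K = x^K`, constant `D_K = 1`.
[folklore] -/
theorem toy_slotAC (h0 : 0 ≤ x) (h1 : x ≤ 1) : ∀ K (t : ℝ), |t| ≤ l₀ → ∀ s ∈ Toy.S K,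
    SlotAntiConcentration (volume.restrict (Icc (0 : ℝ) 1)) (fun y => y) 1 (Toy.ρ x (Toy.lvl K s))
      (Toy.D (Toy.lvl K s)) :=
  fun _ _ _ _ _ => slotAC_unif (pow_le_one₀ h0 h1)

/-- SM-L10 shape: the level constants are uniformly bounded, `D_j = 1 ≤ D̄ = 1` (binder `hD`). [folklore] -/
theorem toy_D_le : ∀ j, Toy.D j ≤ (1 : ℝ) := fun _ => le_rfl

/-- SM-L8 shape: the widths obey the geometric rate `ρ_j = x^j ≤ 1·ϑ^j` for `0 ≤ x ≤ ϑ` (binder `hrate`, `c₁ = 1`).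
[folklore] -/
theorem toy_rate {ϑ : ℝ} (h0 : 0 ≤ x) (hx : x ≤ ϑ) : ∀ j, Toy.ρ x j ≤ 1 * ϑ ^ j :=
  fun j => (pow_le_pow_left₀ h0 hx j).trans_eq (one_mul _).symm

/-- band twin: at most ONE slot of each age `a = K − lvl` (age counts `m ≡ 1`). [folklore] -/
theorem toy_ageCount {N₁ : ℕ} :
    ∀ K, ∀ a ≤ N₁, ((((Toy.S K).filter fun s => K - Toy.lvl K s = a).card : ℕ) : ℝ) ≤ 1 := by
  intro K a _
  have h : ((Toy.S K).filter fun s => K - Toy.lvl K s = a).card ≤ 1 :=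
    (Finset.card_le_card (Finset.filter_subset _ _)).trans (by simp [Toy.S])
  exact_mod_cast h

/-- band twin: the widths `ρ_j = x^j` are summable for `0 ≤ x < 1`. [folklore] -/
theorem toy_summable_ρ (h0 : 0 ≤ x) (h1 : x < 1) : Summable (Toy.ρ x) :=
  summable_geometric_of_lt_one h0 h1

end OneRun

/-! ## §3 END-I FIRES on two toy runs -/

section TwoRuns

variable {a b ϑ : ℝ} (l₀ : ℝ)

/-- **END-I FIRES ON THE TOY.**  Two runs = two copies of the toy with parameters `a, b ∈ (0, ϑ]`, `ϑ < 1` (common term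
family `Toy.T`, weights `A = B ≡ 1`, shell parts `a^K`, `b^K`); per run the slot data of §2 (uniform slot measure on
`[0, 1]`, identity tested variable, `θ ≡ 1`, `M ≡ 1`) with EVERY binder of `shellWeightBound_of_slotAC` supplied by
§2 / `Toy.levelLedger` / `Toy.liveWindow` (`N₁ = 0`, `ν̄ = 1`, `D̄ = 1`, `c₁ = 1`): the END returns LITERALLY
`ShellWeightBound l₀ Toy.T Toy.A Toy.A (Toy.sh a) (Toy.sh b) (K ↦ Σ_s D·ρ^a + Σ_s D·ρ^b)`. [folklore] -/
theorem toy_shellWeightBound (ha0 : 0 < a) (ha : a ≤ ϑ) (hb0 : 0 < b) (hb : b ≤ ϑ) (hϑ1 : ϑ < 1) :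
    ShellWeightBound l₀ Toy.T Toy.A Toy.A (Toy.sh a) (Toy.sh b)
      (fun K => ∑ s ∈ Toy.S K, Toy.D (Toy.lvl K s) * Toy.ρ a (Toy.lvl K s) +
        ∑ s ∈ Toy.S K, Toy.D (Toy.lvl K s) * Toy.ρ b (Toy.lvl K s)) :=
  have ha1 : a ≤ 1 := ha.trans hϑ1.le
  have hb1 : b ≤ 1 := hb.trans hϑ1.le
  shellWeightBound_of_slotAC (ΩA := fun _ _ => ℝ) (ΩB := fun _ _ => ℝ)
    (μA := fun _ _ _ => volume.restrict (Icc (0 : ℝ) 1)) (μB := fun _ _ _ => volume.restrict (Icc (0 : ℝ) 1))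
    (uA := fun _ _ _ y => y) (uB := fun _ _ _ y => y) (θA := fun _ => 1) (θB := fun _ => 1)
    (MA := fun _ _ _ => 1) (MB := fun _ _ _ => 1) (N₁ := 0) (νbar := 1) (Dbar := 1) (c₁ := 1) (ϑ := ϑ)
    (Toy.levelLedger l₀ ha0.le ha1).sh_nonneg (Toy.levelLedger l₀ ha0.le ha1).sh_le
    (Toy.levelLedger l₀ ha0.le ha1).cover (toy_M_nonneg l₀) (toy_piece_le l₀ ha0.le ha1) (toy_total_ge l₀)
    (fun _ => zero_le_one) (fun j => pow_nonneg ha0.le j) (toy_slotAC l₀ ha0.le ha1)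
    (Toy.levelLedger l₀ hb0.le hb1).sh_nonneg (Toy.levelLedger l₀ hb0.le hb1).sh_le
    (Toy.levelLedger l₀ hb0.le hb1).cover (toy_M_nonneg l₀) (toy_piece_le l₀ hb0.le hb1) (toy_total_ge l₀)
    (fun _ => zero_le_one) (fun j => pow_nonneg hb0.le j) (toy_slotAC l₀ hb0.le hb1)
    Toy.liveWindow Toy.liveWindow (ha0.trans_le ha) hϑ1 toy_D_le toy_D_le (toy_rate ha0.le ha) (toy_rate hb0.le hb)

/-- the toy's NE7c shell weight in closed form: `Wsh K = a^K + b^K`. [folklore] -/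
theorem toy_weight_eq (K : ℕ) :
    ∑ s ∈ Toy.S K, Toy.D (Toy.lvl K s) * Toy.ρ a (Toy.lvl K s) +
        ∑ s ∈ Toy.S K, Toy.D (Toy.lvl K s) * Toy.ρ b (Toy.lvl K s) = a ^ K + b ^ K := by
  simp [Toy.S, Toy.D, Toy.ρ, Toy.lvl]

/-- END-I on the toy with the weight in closed form: `ShellWeightBound … (K ↦ a^K + b^K)`. [folklore] -/
theorem toy_shellWeightBound' (ha0 : 0 < a) (ha : a ≤ ϑ) (hb0 : 0 < b) (hb : b ≤ ϑ) (hϑ1 : ϑ < 1) :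
    ShellWeightBound l₀ Toy.T Toy.A Toy.A (Toy.sh a) (Toy.sh b) (fun K => a ^ K + b ^ K) := by
  have h := toy_shellWeightBound l₀ ha0 ha hb0 hb hϑ1
  have e : (fun K => ∑ s ∈ Toy.S K, Toy.D (Toy.lvl K s) * Toy.ρ a (Toy.lvl K s) +
      ∑ s ∈ Toy.S K, Toy.D (Toy.lvl K s) * Toy.ρ b (Toy.lvl K s)) = fun K => a ^ K + b ^ K :=
    funext toy_weight_eq
  rw [e] at h
  exact h

/-- **THE BAND TWIN FIRES ON THE TOY** (road P2's head): the same data with `a, b ∈ (0, 1)` INDEPENDENT — no common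
rate base — the geometric rate replaced by `Summable ρ` and the age counts `m ≡ 1`
(`shellWeightBound_of_slotAC_band`). [folklore] -/
theorem toy_shellWeightBound_band (ha0 : 0 < a) (ha1 : a < 1) (hb0 : 0 < b) (hb1 : b < 1) :
    ShellWeightBound l₀ Toy.T Toy.A Toy.A (Toy.sh a) (Toy.sh b)
      (fun K => ∑ s ∈ Toy.S K, Toy.D (Toy.lvl K s) * Toy.ρ a (Toy.lvl K s) +
        ∑ s ∈ Toy.S K, Toy.D (Toy.lvl K s) * Toy.ρ b (Toy.lvl K s)) :=
  shellWeightBound_of_slotAC_band (ΩA := fun _ _ => ℝ) (ΩB := fun _ _ => ℝ)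
    (μA := fun _ _ _ => volume.restrict (Icc (0 : ℝ) 1)) (μB := fun _ _ _ => volume.restrict (Icc (0 : ℝ) 1))
    (uA := fun _ _ _ y => y) (uB := fun _ _ _ y => y) (θA := fun _ => 1) (θB := fun _ => 1)
    (MA := fun _ _ _ => 1) (MB := fun _ _ _ => 1) (N₁ := 0) (νbar := 1) (Dbar := 1) (m := fun _ => 1)
    (Toy.levelLedger l₀ ha0.le ha1.le).sh_nonneg (Toy.levelLedger l₀ ha0.le ha1.le).sh_le
    (Toy.levelLedger l₀ ha0.le ha1.le).cover (toy_M_nonneg l₀) (toy_piece_le l₀ ha0.le ha1.le) (toy_total_ge l₀)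
    (fun _ => zero_le_one) (fun j => pow_nonneg ha0.le j) (toy_slotAC l₀ ha0.le ha1.le)
    (Toy.levelLedger l₀ hb0.le hb1.le).sh_nonneg (Toy.levelLedger l₀ hb0.le hb1.le).sh_le
    (Toy.levelLedger l₀ hb0.le hb1.le).cover (toy_M_nonneg l₀) (toy_piece_le l₀ hb0.le hb1.le) (toy_total_ge l₀)
    (fun _ => zero_le_one) (fun j => pow_nonneg hb0.le j) (toy_slotAC l₀ hb0.le hb1.le)
    Toy.liveWindow Toy.liveWindow toy_D_le toy_D_le toy_ageCount toy_ageCount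
    (toy_summable_ρ ha0.le ha1) (toy_summable_ρ hb0.le hb1)

/-- the slot-free NE7b half on the toy terms: empty bad class, weight `W ≡ 0`. [folklore] -/
theorem toy_relWeightBound : RelWeightBound l₀ Toy.T Toy.A Toy.A (fun _ _ => ∅) (fun _ => 0) where
  bad_subset _ _ _ := empty_subset _
  nonneg _ := le_rfl
  lt_one _ := zero_lt_one
  summable := summable_zero
  bad_left _ _ _ := by simp [Toy.T, Toy.A]
  bad_right _ _ _ := by simp [Toy.T, Toy.A]

/-- the zero budget on the toy's HYBRID CORES `A − sh = 1 − a^K` (both runs, diagonal `a = b`; `0 ≤ a ≤ 1`): no bad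
class, all constants, radii and rates zero. [folklore] -/
theorem toy_reindexedBudget (vol : ℝ) (h0 : 0 ≤ a) (h1 : a ≤ 1) :
    ReindexedBudget l₀ vol Toy.T (fun K t τ => Toy.A K t τ - Toy.sh a K t τ)
      (fun K t τ => Toy.A K t τ - Toy.sh a K t τ) (fun _ _ => ∅) (fun _ _ _ => 0) (fun _ _ _ => 0) (fun _ _ _ => 0)
      (fun _ _ _ => 0) (fun _ => 0) (fun _ => 0) (fun _ => 0) (fun _ => 0) (fun _ => 0) (fun _ => 0) where
  nonneg K _ _ _ _ := sub_nonneg.2 (pow_le_one₀ (n := K) h0 h1)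
  lower _ _ _ _ _ := by simp
  upper _ _ _ _ _ := by simp
  uv_const _ _ _ _ _ := by simp
  uv_radius _ _ _ _ _ := by simp
  recent_remainder _ _ _ _ _ := by simp
  recent_deviation _ _ _ _ _ := by simp

/-- **END-I THROUGH THE SEAM (ζ′) FIRES ON THE TOY** (diagonal `a = b ∈ (0, 1)`): the binders of
`hybridNE7_tail_of_slotAC` — END-I's, PLUS the slot-free NE7b half, the zero budget on the hybrid cores `1 − a^K` and
zero producer rates — are jointly satisfiable WITH A NONZERO SHELL, and the seam returns a `HybridNE7` datum for the
shifted families with shell weight `K ↦ Σ_s D·ρ + Σ_s D·ρ` (`= 2a^{K₀+K}`). [folklore] -/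
theorem toy_hybridNE7_tail (vol : ℝ) (ha0 : 0 < a) (ha1 : a < 1) :
    ∃ K₀, HybridNE7 l₀ vol (fun K => Toy.T (K₀ + K)) (fun K => Toy.A (K₀ + K)) (fun K => Toy.A (K₀ + K))
      (fun _ _ => (∅ : Finset Unit)) (fun _ => (0 : ℝ)) (fun K => Toy.sh a (K₀ + K)) (fun K => Toy.sh a (K₀ + K))
      (fun K => ∑ s ∈ Toy.S (K₀ + K), Toy.D (Toy.lvl (K₀ + K) s) * Toy.ρ a (Toy.lvl (K₀ + K) s) +
        ∑ s ∈ Toy.S (K₀ + K), Toy.D (Toy.lvl (K₀ + K) s) * Toy.ρ a (Toy.lvl (K₀ + K) s))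
      (fun _ => ((0 : ℝ) + 0) + (0 + 0)) :=
  hybridNE7_tail_of_slotAC (ΩA := fun _ _ => ℝ) (ΩB := fun _ _ => ℝ)
    (μA := fun _ _ _ => volume.restrict (Icc (0 : ℝ) 1)) (μB := fun _ _ _ => volume.restrict (Icc (0 : ℝ) 1))
    (uA := fun _ _ _ y => y) (uB := fun _ _ _ y => y) (θA := fun _ => 1) (θB := fun _ => 1)
    (MA := fun _ _ _ => 1) (MB := fun _ _ _ => 1) (N₁ := 0) (νbar := 1) (Dbar := 1) (c₁ := 1) (ϑ := a)
    (Bad := fun _ _ => ∅) (W := fun _ => 0)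
    (Toy.levelLedger l₀ ha0.le ha1.le).sh_nonneg (Toy.levelLedger l₀ ha0.le ha1.le).sh_le
    (Toy.levelLedger l₀ ha0.le ha1.le).cover (toy_M_nonneg l₀) (toy_piece_le l₀ ha0.le ha1.le) (toy_total_ge l₀)
    (fun _ => zero_le_one) (fun j => pow_nonneg ha0.le j) (toy_slotAC l₀ ha0.le ha1.le)
    (Toy.levelLedger l₀ ha0.le ha1.le).sh_nonneg (Toy.levelLedger l₀ ha0.le ha1.le).sh_le
    (Toy.levelLedger l₀ ha0.le ha1.le).cover (toy_M_nonneg l₀) (toy_piece_le l₀ ha0.le ha1.le) (toy_total_ge l₀)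
    (fun _ => zero_le_one) (fun j => pow_nonneg ha0.le j) (toy_slotAC l₀ ha0.le ha1.le)
    Toy.liveWindow Toy.liveWindow ha0 ha1 toy_D_le toy_D_le (toy_rate ha0.le le_rfl) (toy_rate ha0.le le_rfl)
    (toy_relWeightBound l₀) (toy_reindexedBudget l₀ vol ha0.le ha1.le)
    summable_zero summable_zero summable_zero summable_zero

end TwoRuns

/-! ## §4 Non-degeneracy: positive shell part, live slot, exact relative shell weight, sharp constant -/

section NonDegenerate

variable {a : ℝ}

/-- the toy's shell part is STRICTLY POSITIVE at every step (`0 < a`). [folklore] -/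
theorem toy_sh_pos (ha0 : 0 < a) (K : ℕ) (t : ℝ) (τ : Unit) : 0 < Toy.sh a K t τ :=
  pow_pos ha0 K

/-- the slot is LIVE at every step: its level-`K` threshold shell has positive uniform mass `a^K` (`0 < a ≤ 1`).
[folklore] -/
theorem toy_shellMass_pos (ha0 : 0 < a) (ha1 : a ≤ 1) (K : ℕ) (s : Unit) :
    0 < (volume.restrict (Icc (0 : ℝ) 1)) {y : ℝ | 1 * (1 - Toy.ρ a (Toy.lvl K s)) ≤ y ∧ y < 1} := by
  show 0 < (volume.restrict (Icc (0 : ℝ) 1)) {y : ℝ | 1 * (1 - a ^ K) ≤ y ∧ y < 1}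
  rw [unif_shell (pow_le_one₀ ha0.le ha1), ENNReal.ofReal_pos]
  exact pow_pos ha0 K

/-- run A's own relative shell weight is EXACTLY `a^K`: `Σ_τ sh = a^K · Σ_τ A` (END-I's `left` field
`Σ sh ≤ (a^K + b^K)·Σ A` is off by the other run's weight only). [folklore] -/
theorem toy_relShell_eq (K : ℕ) (t : ℝ) :
    ∑ τ ∈ Toy.T K, Toy.sh a K t τ = a ^ K * ∑ τ ∈ Toy.T K, Toy.A K t τ := by
  simp [Toy.T, Toy.sh, Toy.A]

/-- the per-slot constant is SHARP on the toy: at step `K` (width `a^K`, `0 < a ≤ 1`) the uniform slot measure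
satisfies (M1) with constant `D` iff `1 ≤ D`. [folklore] -/
theorem toy_slotAC_iff (ha0 : 0 < a) (ha1 : a ≤ 1) (K : ℕ) (s : Unit) {D : ℝ} :
    SlotAntiConcentration (volume.restrict (Icc (0 : ℝ) 1)) (fun y => y) 1 (Toy.ρ a (Toy.lvl K s)) D ↔ 1 ≤ D :=
  slotAC_unif_iff (ρ := a ^ K) (pow_pos ha0 K) (pow_le_one₀ ha0.le ha1)

end NonDegenerate

/-! ## §5 (v1.1, crew referee DV-4) The toy's piece is an HONEST integral -/

section HonestIntegral

variable {x : ℝ}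

/-- the integrand behind the toy's piece — the indicator of the slot's level-`K` threshold shell, against the slot's
realized measure (the uniform law on `[0, 1]`, finite) — is INTEGRABLE (measurable set, constant `1`): no Bochner
junk value is involved (crew referee DV-4). [folklore] -/
theorem toy_piece_integrable (K : ℕ) (s : Unit) :
    Integrable ({y : ℝ | 1 * (1 - Toy.ρ x (Toy.lvl K s)) ≤ y ∧ y < 1}.indicator fun _ => (1 : ℝ))
      (volume.restrict (Icc (0 : ℝ) 1)) :=
  (integrable_const (1 : ℝ)).indicator (by rw [shell_eq_Ico]; exact measurableSet_Ico)

/-- **THE TOY'S PIECE IS AN HONEST INTEGRAL (DV-4).**  `piece x K t s τ = x^K` is LITERALLY the Bochner integral of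
the indicator of the slot's level-`K` threshold shell `{1·(1 − x^K) ≤ u < 1}` against the slot's realized measure
(`0 ≤ x ≤ 1`); hence §2's [dict] push `toy_piece_le` is the honest instance `∫ 1_shell dμ ≤ 1 · μ(shell)` of END-I's
binder `piece_le`, not a bound on a junk value. [folklore] -/
theorem toy_piece_eq_integral (h0 : 0 ≤ x) (h1 : x ≤ 1) (K : ℕ) (t : ℝ) (s τ : Unit) :
    Toy.piece x K t s τ =
      ∫ y, {y : ℝ | 1 * (1 - Toy.ρ x (Toy.lvl K s)) ≤ y ∧ y < 1}.indicator (fun _ => (1 : ℝ)) y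
        ∂(volume.restrict (Icc (0 : ℝ) 1)) := by
  show x ^ K = ∫ y, {y : ℝ | 1 * (1 - x ^ K) ≤ y ∧ y < 1}.indicator (fun _ => (1 : ℝ)) y
    ∂(volume.restrict (Icc (0 : ℝ) 1))
  have hmeas : MeasurableSet {y : ℝ | 1 * (1 - x ^ K) ≤ y ∧ y < 1} := by
    rw [shell_eq_Ico]; exact measurableSet_Ico
  rw [integral_indicator_const (1 : ℝ) hmeas, smul_eq_mul, mul_one, measureReal_def,
    unif_shell (pow_le_one₀ h0 h1), ENNReal.toReal_ofReal (pow_nonneg h0 K)]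

end HonestIntegral

/-! ## §6 (v1.2, typer acceptance shape, `t4/formal/NE7c/LEAVES.md` row S10) END-I applied ∧ the weight positive -/

section Acceptance

variable {a b ϑ : ℝ}

/-- the toy's NE7c shell weight `a^K + b^K` is STRICTLY POSITIVE at every step (`0 < a`, `0 < b`). [folklore] -/
theorem toy_weight_pos (ha0 : 0 < a) (hb0 : 0 < b) (K : ℕ) : 0 < a ^ K + b ^ K :=
  add_pos (pow_pos ha0 K) (pow_pos hb0 K)

/-- **THE TYPER'S ACCEPTANCE SHAPE FOR ROW S10 AS ONE CLOSED THEOREM**: END-I applied to the explicit toy data gives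
`ShellWeightBound l₀ Toy.T Toy.A Toy.A (Toy.sh a) (Toy.sh b) Wsh` with `Wsh K = a^K + b^K`, AND `0 < Wsh K` at EVERY
step `K` (`a, b ∈ (0, ϑ]`, `ϑ < 1`). [folklore] -/
theorem toy_END_I (l₀ : ℝ) (ha0 : 0 < a) (ha : a ≤ ϑ) (hb0 : 0 < b) (hb : b ≤ ϑ) (hϑ1 : ϑ < 1) :
    ShellWeightBound l₀ Toy.T Toy.A Toy.A (Toy.sh a) (Toy.sh b) (fun K => a ^ K + b ^ K) ∧
      ∀ K, 0 < a ^ K + b ^ K :=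
  ⟨toy_shellWeightBound' l₀ ha0 ha hb0 hb hϑ1, toy_weight_pos ha0 hb0⟩

/-- … and a PARAMETER-FREE instance (`a = b = ϑ = 1/2`), literally the typer's
`∃ Wsh, ShellWeightBound l₀ T A B shA shB Wsh ∧ 0 < Wsh K₀` (for every `K₀`). [folklore] -/
theorem toy_END_I_half (l₀ : ℝ) (K₀ : ℕ) :
    ∃ Wsh : ℕ → ℝ,
      ShellWeightBound l₀ Toy.T Toy.A Toy.A (Toy.sh (1 / 2)) (Toy.sh (1 / 2)) Wsh ∧ 0 < Wsh K₀ :=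
  ⟨fun K => (1 / 2 : ℝ) ^ K + (1 / 2) ^ K,
    (toy_END_I l₀ (a := 1 / 2) (b := 1 / 2) (ϑ := 1 / 2) one_half_pos le_rfl one_half_pos le_rfl
      one_half_lt_one).1,
    toy_weight_pos one_half_pos one_half_pos K₀⟩

end Acceptance

end Summit.QuantumFields.BalabanUV.T4Continuum.ShellMeasureRootCompositionToy
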